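import Literature.MathematicalPhysics.QuantumFieldTheory.Balaban1983to89.B8IdxB8LawsB

/-!
# `Balaban1983to89.B8TowerBondsPrinted` — [Balaban1985RegularSpaces] PRINT'S CONSTRAINT-BOND CLASS OF A Λ-TOWER, CROSSING BONDS INCLUDED
# ((1.31) p. 82: the contours of an inner bond `⟨x, x′⟩ ⊂ Λ_j` AND of a crossing bond «`b₋ ∈ Λ_j`, `Γ_{b₋,x} ⊂ Λ_{j−1}`»; [Balaban1984PropagatorsII]
# (2.3) p. 224 for bonds): the class `towerBondsP L Ω Λ j ⊇ B8IdxB8LawsB.towerBonds L Ω Λ j` with the LEVEL-SPLIT box law «inner: box ⊂ Ω_j;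
# crossing: box ⊂ Ω_{j−1}», its laws, and its reading at the sub-index of record `IdxB8SubB θ` — the datum class the `Ω₀ = ℤᵈ` road's
# edition γ supplies to the class-parametric (1.59) socket and Theorem-4 ∕ Proposition-3 drivers

statement-level skeleton of published theorems with citation tags; ONE definition + lattice bookkeeping; nothing here is a claim about
the Yang–Mills mass gap

T. Bałaban, *Spaces of regular gauge field configurations on a lattice and gauge fixing conditions*, Commun. Math. Phys. **99** (1985)
75–102 `[Balaban1985RegularSpaces]` ("B8"): p. 77 (bond convention «Ω also denotes the set of bonds with at least one end-point in Ω»;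
(1.5) «Λ_j = Ω_j^{(j)} ∖ Ω_{j+1}^{(j)}»), (1.12) p. 78 («𝔅_k = ⋃_j Λ_j (the same for the sets of bonds)»), (1.31) p. 82 (the averaging
constraints for inner bonds `b ⊂ Λ_j` AND for the crossing case «b₋ ∈ Λ_{j}, …, Γ ⊂ Λ_{j−1}»), (1.37) p. 82, (1.42) p. 83, (1.57)–(1.59)
p. 86 (`|B₁| = sup` over the constraint bonds).  T. Bałaban, *Propagators and renormalization transformations for lattice gauge theories. II*,
Commun. Math. Phys. **96** (1984) 223–250 `[Balaban1984PropagatorsII]` ("B6"), (2.3) p. 224 (the bond classes of a sequence of domains).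
PDF held: `paper:balaban1985-cmp99-regular-spaces-gauge-fixing` (journal page = PDF page + 74): p0008 L1–8 ((1.31), both cases),
p0012 L15–27 ((1.57)–(1.59)).

CITATION HEADER (lean-in-tree rule).  Cell `pub-ymgap` (HUMAN RULING D-0062, Track A), DAG node N05 = [B8], seat `pub-ymgap-dag-n05-d`
(g10; R134 row s2, the `Ω₀ = ℤᵈ` road's consumer of record).  WHY THIS FILE.  dag-n05-c g11 LOCATED (certificates `B8Ineq159FlatShellModeVacuity`
p572834, `B8SockB9P3ShellModeVacuityUniv` p576185; this seat's corollary `B8SockB9P3UnivBinderVacuity` p578866) that the MAXIMAL class a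
`B8LeafModelZd.ZdIdx` member can carry — `B8IdxB8LawsB.towerBonds` (law №12), whose `hbox` conjunct «box ⊂ Ω_j» EMPTIES the two crossing
disjuncts over every print-like tower (`B8Ineq159FlatCubeMemberPrinted.towerBonds_inner_of_printTower`) — misses print's (1.31) crossing
contours, so every (1.59)-type socket keyed on `i.Λb` is unsatisfiable above truncation `0` (interior-shell gauge zero mode).  The repair of
record is CLASS-AS-PARAMETER (`ZdIdx.hbox` is a structure field; no edit): dag-n05-c's `cubeLamBP` (p573921) is print's class at the CUBE
members; dag-n06-b's edition-γ suppliers (`B9SupplySockB9P3ZdGamma(Univ)`) and dag-n05-e's edition-γ Theorem-4 driver take the class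
`ΛbP ⊇ i.Λb` as an argument with the box law «box ⊂ Ω_{j−1}» (dag-n05-e CONSUMER-REQS-γ (R1)–(R3), cell bus 2026-08-27).  THIS FILE supplies
the class for the `Ω₀ = ℤᵈ` LAW members (a generic Λ-tower `(Ω, Λ = Λs m)`): `towerBondsP`, = `towerBonds` with its first conjunct
LEVEL-SPLIT («box ⊂ Ω_j» for the inner disjunct, «box ⊂ Ω_{j−1}» for the two crossing disjuncts; `j − 1` in `ℕ`, so level `0` reads `Ω_0`
and has no crossing bond), and the laws the γ consumers read.

WHAT THIS FILE PROVES (one `def`, lattice bookkeeping; no analysis).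
* `towerBondsP`, `mem_towerBondsP_iff` (`Iff.rfl`).
* `towerBonds_subset_towerBondsP` (nested `Ω`): the typed class is part of print's; `ZdIdx.lamB_subset_towerBondsP` (any member, via
  `B8IdxB8LawsB.ZdIdx.Λb_subset_towerBonds`); `IdxB8LawsB.lamB_subset_towerBondsP` (law members, all `m, j`).
* `towerBondsP_box_subset_pred` (nested `Ω`): the γ box law «box ⊂ Ω_{j−1}» for EVERY bond of the class; `towerBondsP_box_subset_of_inner`.
* `towerBondsP_hclass`: the three `ZdIdx.hclass` disjuncts w.r.t. `Λ`.
* `towerBondsP_zero_eq` (level `0`: no crossing disjunct ⇒ `= towerBonds … 0`), `towerBondsP_univ_self` (`Ω_j = Λ_j = ℤᵈ` ⇒ ALL level-`j`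
  bonds — the A6 hook «`∀ b, b ∈ ΛbP 0 0`» of dag-n06-b's truncation-`0` witnesses at the `Ω₀ = ℤᵈ` law members, whose `Λs 0 0 = ℤᵈ` by
  `B8IdxB8LawsCoverZero.lamS_zero_zero_eq_univ`), `towerBondsP_mono` (monotone in `Λ` level-wise and in `Ω`).
* `crossing_mem_towerBondsP` ∕ `crossingMirror_mem_towerBondsP`: the two (1.31) crossing cases ARE members (introduction rules) — the class
  is print's, not the typed one.

HONEST SCOPE.  One definition + `Iff.rfl`-level set bookkeeping; NO estimate; nothing of [Balaban1985RegularSpaces]'s analysis asserted; whether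
the (1.59) socket over `towerBondsP` is satisfiable at `m ≥ 1` is N06's ∕ N05's open content (the class only removes the certified shell-mode
obstruction's CAUSE — the missing crossing datum; no inhabitant above truncation `0` is claimed here); N05 NOT discharged; count-neutral;
`T_η ↦ ℤᵈ`; one finite `T⁴` programme at fixed `ε`, Bałaban as printed — nothing continuum ∕ ℝ⁴ ∕ OS ∕ mass-gap ∕ Clay.  No `sorry`, no
`axiom`, no `instance`, no `notation`.  Unit `pub-ymgap-dag-n05-d` (g10), 2026-08-27.

RELATED IN THE TREE, NOT DUPLICATED: `B8IdxB8LawsB.towerBonds` (the typed maximal class, USED), `B8Ineq159FlatCubeMemberPrinted.cubeLamBP`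
(print's class at the cube members — the cube road's twin of this file; its box law `cubeLamBP_box_subset_pred` is a theorem there because the
class is defined geometrically; here the box law is part of the definition, as in `towerBonds`), `B9SupplySockB9P3ZdGamma.SeesDom` (dag-n06-b's
locality law for finite `Ω₀`; vacuous companion at `Ω₀ = ℤᵈ`).
-/

noncomputable section

namespace Literature.MathematicalPhysics.QuantumFieldTheory.Balaban1983to89.B8TowerBondsPrinted

open B7Prop1Explicit B7Prop1Local
open B8Thm2LogB (blockTop)
open B8LeafModelZd (ZdIdx)
open B8IdxB8LawsB (towerBonds mem_towerBonds_iff IdxB8LawsB IdxB8SubB)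
open Node00 (Stage3Params)

-- `Site` alone could resolve to the torus sites of `Setup.lean`; re-export the `ℤ^d` sites of `B7Prop1Explicit`.
export B7Prop1Explicit (Site)

variable {d : ℕ}

/-! ## §1 Print's class of a Λ-tower: inner bonds with box in `Ω_j`, crossing bonds with box in `Ω_{j−1}` -/

/-- **PRINT'S CONSTRAINT BONDS OF THE Λ-TOWER AT LEVEL `j`** ((1.31) p. 82 ∕ [B6] (2.3) p. 224), for the region sequence `Ω` and one truncation
`Λ` of the constraint tower: the level-`j` bonds `c = ⟨c₋, c₋ + e_κ⟩` that are INNER (both ends in `Λ_j`, fine box `Bʲ(c₋) ∪ Bʲ(c₊) ⊂ Ω_j`) OR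
CROSSING (one end in `Λ_j`, the `L`-block under the other end in `Λ_{j−1}` — «b₋ ∈ Λ_j, Γ_{b₋,x} ⊂ Λ_{j−1}» — fine box `⊂ Ω_{j−1}`).  The three
membership disjuncts are `B8LeafModelZd.ZdIdx.hclass`'s VERBATIM; the box conjunct is `towerBonds`' «box ⊂ Ω_j» SPLIT BY LEVEL (dag-n05-e
CONSUMER-REQS-γ (R1)): `ℕ`-subtraction, so at `j = 0` both read `Ω_0` and the crossing disjuncts (`j = j′ + 1`) are empty.
[cite: Balaban1985RegularSpaces, (1.31) p.82, (1.37) p.82, (1.42) p.83, (1.12) p.78, p.77; Balaban1984PropagatorsII, (2.3) p.224] -/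
def towerBondsP (L : ℕ) (Ω : ℕ → Set (Site d)) (Λ : ℕ → Set (Site d)) (j : ℕ) : Set (Site d × Fin d) :=
  {c | ((∀ x, InBox (loK L j c.1) (bondHiK L j c.1 c.2) x → x ∈ Ω j) ∧ c.1 ∈ Λ j ∧ c.1 + e c.2 ∈ Λ j) ∨
    ((∀ x, InBox (loK L j c.1) (bondHiK L j c.1 c.2) x → x ∈ Ω (j - 1)) ∧
      ((∃ j', j = j' + 1 ∧ (∀ x, (L : ℤ) • c.1 ≤ x → x ≤ (L : ℤ) • c.1 + blockTop L → x ∈ Λ j') ∧ c.1 + e c.2 ∈ Λ j) ∨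
        (∃ j', j = j' + 1 ∧ c.1 ∈ Λ j ∧ (∀ x, (L : ℤ) • (c.1 + e c.2) ≤ x → x ≤ (L : ℤ) • (c.1 + e c.2) + blockTop L → x ∈ Λ j'))))}

/-- Membership in `towerBondsP`, unfolded (`Iff.rfl`). [cite: Balaban1985RegularSpaces, (1.31) p.82; Balaban1984PropagatorsII, (2.3) p.224] -/
theorem mem_towerBondsP_iff (L : ℕ) (Ω Λ : ℕ → Set (Site d)) (j : ℕ) (c : Site d × Fin d) :
    c ∈ towerBondsP L Ω Λ j ↔
      ((∀ x, InBox (loK L j c.1) (bondHiK L j c.1 c.2) x → x ∈ Ω j) ∧ c.1 ∈ Λ j ∧ c.1 + e c.2 ∈ Λ j) ∨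
      ((∀ x, InBox (loK L j c.1) (bondHiK L j c.1 c.2) x → x ∈ Ω (j - 1)) ∧
        ((∃ j', j = j' + 1 ∧ (∀ x, (L : ℤ) • c.1 ≤ x → x ≤ (L : ℤ) • c.1 + blockTop L → x ∈ Λ j') ∧ c.1 + e c.2 ∈ Λ j) ∨
          (∃ j', j = j' + 1 ∧ c.1 ∈ Λ j ∧ (∀ x, (L : ℤ) • (c.1 + e c.2) ≤ x → x ≤ (L : ℤ) • (c.1 + e c.2) + blockTop L → x ∈ Λ j')))) :=
  Iff.rfl

/-- **The INNER case as an introduction rule** ((1.31)₁: «⟨x, x′⟩ ⊂ Λ_j», box in `Ω_j`). [cite: Balaban1985RegularSpaces, (1.31) p.82] -/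
theorem inner_mem_towerBondsP (L : ℕ) {Ω Λ : ℕ → Set (Site d)} {j : ℕ} {c : Site d × Fin d}
    (hbox : ∀ x, InBox (loK L j c.1) (bondHiK L j c.1 c.2) x → x ∈ Ω j) (h₁ : c.1 ∈ Λ j) (h₂ : c.1 + e c.2 ∈ Λ j) :
    c ∈ towerBondsP L Ω Λ j :=
  Or.inl ⟨hbox, h₁, h₂⟩

/-- **The CROSSING case as an introduction rule** ((1.31)₂: the `L`-block under `c₋` in `Λ_{j′}`, `c₊ ∈ Λ_{j′+1}`, box in `Ω_{j′}`) — the members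
`towerBonds` lacks over print-like towers. [cite: Balaban1985RegularSpaces, (1.31) p.82, (1.42) p.83; Balaban1984PropagatorsII, (2.3) p.224] -/
theorem crossing_mem_towerBondsP (L : ℕ) {Ω Λ : ℕ → Set (Site d)} {j' : ℕ} {c : Site d × Fin d}
    (hbox : ∀ x, InBox (loK L (j' + 1) c.1) (bondHiK L (j' + 1) c.1 c.2) x → x ∈ Ω j')
    (hblk : ∀ x, (L : ℤ) • c.1 ≤ x → x ≤ (L : ℤ) • c.1 + blockTop L → x ∈ Λ j') (h₂ : c.1 + e c.2 ∈ Λ (j' + 1)) :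
    c ∈ towerBondsP L Ω Λ (j' + 1) :=
  Or.inr ⟨by rw [Nat.add_sub_cancel]; exact hbox, Or.inl ⟨j', rfl, hblk, h₂⟩⟩

/-- **The MIRRORED crossing case as an introduction rule** (`c₋ ∈ Λ_{j′+1}`, the `L`-block under `c₊` in `Λ_{j′}`, box in `Ω_{j′}`).
[cite: Balaban1985RegularSpaces, (1.31) p.82, (1.42) p.83; Balaban1984PropagatorsII, (2.3) p.224] -/
theorem crossingMirror_mem_towerBondsP (L : ℕ) {Ω Λ : ℕ → Set (Site d)} {j' : ℕ} {c : Site d × Fin d}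
    (hbox : ∀ x, InBox (loK L (j' + 1) c.1) (bondHiK L (j' + 1) c.1 c.2) x → x ∈ Ω j') (h₁ : c.1 ∈ Λ (j' + 1))
    (hblk : ∀ x, (L : ℤ) • (c.1 + e c.2) ≤ x → x ≤ (L : ℤ) • (c.1 + e c.2) + blockTop L → x ∈ Λ j') :
    c ∈ towerBondsP L Ω Λ (j' + 1) :=
  Or.inr ⟨by rw [Nat.add_sub_cancel]; exact hbox, Or.inr ⟨j', rfl, h₁, hblk⟩⟩

/-! ## §2 The laws the edition-γ consumers read -/

/-- **THE TYPED CLASS IS PART OF PRINT'S** (nested regions `Ω_{j+1} ⊆ Ω_j`, so «box ⊂ Ω_j» gives «box ⊂ Ω_{j−1}» for the crossing disjuncts):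
`towerBonds L Ω Λ j ⊆ towerBondsP L Ω Λ j`. [cite: Balaban1985RegularSpaces, (1.31) p.82, (1.3) p.77 («Ω_0 ⊃ Ω_1 ⊃ …»)] -/
theorem towerBonds_subset_towerBondsP (L : ℕ) {Ω : ℕ → Set (Site d)} (hΩ : ∀ j, Ω (j + 1) ⊆ Ω j) (Λ : ℕ → Set (Site d)) (j : ℕ) :
    towerBonds L Ω Λ j ⊆ towerBondsP L Ω Λ j := by
  intro c hc
  obtain ⟨hbox, hcls⟩ := hc
  rcases hcls with h | h | h
  · exact Or.inl ⟨hbox, h⟩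
  · obtain ⟨j', hj, hrest⟩ := h
    refine Or.inr ⟨fun x hx => ?_, Or.inl ⟨j', hj, hrest⟩⟩
    subst hj
    rw [Nat.add_sub_cancel]
    exact hΩ j' (hbox x hx)
  · obtain ⟨j', hj, hrest⟩ := h
    refine Or.inr ⟨fun x hx => ?_, Or.inr ⟨j', hj, hrest⟩⟩
    subst hj
    rw [Nat.add_sub_cancel]
    exact hΩ j' (hbox x hx)

/-- **THE γ BOX LAW**: over nested regions EVERY bond of print's class has its fine box in `Ω_{j−1}` (`Ω_{−1} := Ω_0`) — the law dag-n05-e's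
edition-γ Theorem-4 driver takes on its datum class (CONSUMER-REQS-γ (R2); print p. 98: the contours Γ stay one collar inside).
[cite: Balaban1985RegularSpaces, (1.31) p.82, (1.42) p.83, p.98] -/
theorem towerBondsP_box_subset_pred (L : ℕ) {Ω : ℕ → Set (Site d)} (hΩ : ∀ j, Ω (j + 1) ⊆ Ω j) (Λ : ℕ → Set (Site d)) {j : ℕ}
    {c : Site d × Fin d} (hc : c ∈ towerBondsP L Ω Λ j) :
    ∀ x, InBox (loK L j c.1) (bondHiK L j c.1 c.2) x → x ∈ Ω (j - 1) := by
  intro x hx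
  rcases hc with ⟨hbox, -⟩ | ⟨hbox, -⟩
  · rcases j with _ | j
    · exact hbox x hx
    · rw [Nat.add_sub_cancel]
      exact hΩ j (hbox x hx)
  · exact hbox x hx

/-- **THE `ZdIdx` CLASS LAW** holds on print's class: every member is inner, crossing or mirrored-crossing w.r.t. `Λ` (the three disjuncts of
`B8LeafModelZd.ZdIdx.hclass`, read off the definition). [cite: Balaban1985RegularSpaces, (1.31) p.82, (1.37) p.82, (1.42) p.83] -/
theorem towerBondsP_hclass (L : ℕ) {Ω Λ : ℕ → Set (Site d)} {j : ℕ} {c : Site d × Fin d} (hc : c ∈ towerBondsP L Ω Λ j) :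
    (c.1 ∈ Λ j ∧ c.1 + e c.2 ∈ Λ j) ∨
      (∃ j', j = j' + 1 ∧ (∀ x, (L : ℤ) • c.1 ≤ x → x ≤ (L : ℤ) • c.1 + blockTop L → x ∈ Λ j') ∧ c.1 + e c.2 ∈ Λ j) ∨
      (∃ j', j = j' + 1 ∧ c.1 ∈ Λ j ∧ (∀ x, (L : ℤ) • (c.1 + e c.2) ≤ x → x ≤ (L : ℤ) • (c.1 + e c.2) + blockTop L → x ∈ Λ j')) := by
  rcases hc with ⟨-, h⟩ | ⟨-, h | h⟩
  · exact Or.inl h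
  · exact Or.inr (Or.inl h)
  · exact Or.inr (Or.inr h)

/-- The class laws packaged in the quantifier shape of `B8LeafModelZd.ZdIdx.hbox` ∕ `.hclass` for the member-wise class map
`(m, j) ↦ towerBondsP L Ω (Λs m) j` (the shape dag-n05-e's ∕ dag-n06-b's γ files quantify over), box law at `Ω (j − 1)`.
[cite: Balaban1985RegularSpaces, (1.31) p.82, (1.42) p.83] -/
theorem towerBondsP_laws (L : ℕ) {Ω : ℕ → Set (Site d)} (hΩ : ∀ j, Ω (j + 1) ⊆ Ω j) (Λs : ℕ → ℕ → Set (Site d)) (k : ℕ) :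
    (∀ m, m ≤ k → ∀ j, j ≤ m → ∀ c ∈ towerBondsP L Ω (Λs m) j, ∀ x, InBox (loK L j c.1) (bondHiK L j c.1 c.2) x → x ∈ Ω (j - 1)) ∧
    (∀ m, m ≤ k → ∀ j, j ≤ m → ∀ c ∈ towerBondsP L Ω (Λs m) j,
      (c.1 ∈ Λs m j ∧ c.1 + e c.2 ∈ Λs m j) ∨
      (∃ j', j = j' + 1 ∧ (∀ x, (L : ℤ) • c.1 ≤ x → x ≤ (L : ℤ) • c.1 + blockTop L → x ∈ Λs m j') ∧ c.1 + e c.2 ∈ Λs m j) ∨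
      (∃ j', j = j' + 1 ∧ c.1 ∈ Λs m j ∧ (∀ x, (L : ℤ) • (c.1 + e c.2) ≤ x → x ≤ (L : ℤ) • (c.1 + e c.2) + blockTop L → x ∈ Λs m j'))) :=
  ⟨fun m _ _ _ _ hc => towerBondsP_box_subset_pred L hΩ (Λs m) hc, fun _ _ _ _ _ hc => towerBondsP_hclass L hc⟩

/-- **AT LEVEL `0` THERE IS NO CROSSING BOND** (`0 = j′ + 1` is impossible): `towerBondsP … 0 = towerBonds … 0` — the level-`0` datum of the
`Ω₀ = ℤᵈ` road is unchanged by the repair (at `Ω₀ = ℤᵈ` there is no boundary of `Ω₀` either). [cite: Balaban1985RegularSpaces, (1.31) p.82, p.77] -/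
theorem towerBondsP_zero_eq (L : ℕ) (Ω Λ : ℕ → Set (Site d)) : towerBondsP L Ω Λ 0 = towerBonds L Ω Λ 0 := by
  ext c
  rw [mem_towerBondsP_iff, mem_towerBonds_iff]
  constructor
  · rintro (⟨hbox, h⟩ | ⟨_, ⟨j', hj, _⟩ | ⟨j', hj, _⟩⟩)
    · exact ⟨hbox, Or.inl h⟩
    · exact absurd hj (by omega)
    · exact absurd hj (by omega)
  · rintro ⟨hbox, h | ⟨j', hj, _⟩ | ⟨j', hj, _⟩⟩
    · exact Or.inl ⟨hbox, h⟩
    · exact absurd hj (by omega)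
    · exact absurd hj (by omega)

/-- **At a level where `Ω_j = ℤᵈ` and `Λ_j = ℤᵈ` print's class is ALL level-`j` bonds** (every bond is inner with box in `ℤᵈ`) — in particular
`towerBondsP L Ω (Λs 0) 0 = univ` at an `Ω₀ = ℤᵈ` law member (`Λs 0 0 = ℤᵈ` by `B8IdxB8LawsCoverZero.lamS_zero_zero_eq_univ`), the hook
«`∀ b, b ∈ ΛbP 0 0`» of dag-n06-b's truncation-`0` witnesses `binders_inhabited_univ_zero_linP`.
[cite: Balaban1985RegularSpaces, p.77 («we admit Ω_j = T_η»), (1.31) p.82] -/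
theorem towerBondsP_univ_self (L : ℕ) {Ω Λ : ℕ → Set (Site d)} {j : ℕ} (hΩ : Ω j = Set.univ) (hΛ : Λ j = Set.univ) :
    towerBondsP L Ω Λ j = Set.univ := by
  ext c
  simp only [mem_towerBondsP_iff, hΩ, hΛ, Set.mem_univ, imp_true_iff, and_self, true_or]

/-- `towerBondsP` is MONOTONE in the tower level-wise and in the regions. [cite: Balaban1985RegularSpaces, (1.31) p.82 (bookkeeping)] -/
theorem towerBondsP_mono (L : ℕ) {Ω Ω' : ℕ → Set (Site d)} {Λ Λ' : ℕ → Set (Site d)} (hΩ : ∀ j, Ω j ⊆ Ω' j) (hΛ : ∀ j, Λ j ⊆ Λ' j)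
    (j : ℕ) : towerBondsP L Ω Λ j ⊆ towerBondsP L Ω' Λ' j := by
  rintro c (⟨hbox, h₁, h₂⟩ | ⟨hbox, ⟨j', hj, hblk, h₂⟩ | ⟨j', hj, h₁, hblk⟩⟩)
  · exact Or.inl ⟨fun x hx => hΩ _ (hbox x hx), hΛ _ h₁, hΛ _ h₂⟩
  · exact Or.inr ⟨fun x hx => hΩ _ (hbox x hx), Or.inl ⟨j', hj, fun x h1 h2 => hΛ _ (hblk x h1 h2), hΛ _ h₂⟩⟩
  · exact Or.inr ⟨fun x hx => hΩ _ (hbox x hx), Or.inr ⟨j', hj, hΛ _ h₁, fun x h1 h2 => hΛ _ (hblk x h1 h2)⟩⟩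

/-! ## §3 Reading at the members: the member's own class lies inside print's class -/

/-- **EVERY `ZdIdx` MEMBER'S BOND CLASS LIES IN PRINT'S CLASS OF ITS OWN TOWER** (`j ≤ m ≤ k`): maximality
`B8IdxB8LawsB.ZdIdx.Λb_subset_towerBonds` then `towerBonds ⊆ towerBondsP` (regions nested by `ZdIdx.hΩ`) — the `hsub : i.Λb ⊆ ΛbP i` the
class-parametric γ drivers use to restrict their (1.37)∕(1.42) conclusions to the member's carrier. [cite: Balaban1985RegularSpaces, (1.31) p.82, (1.37) p.82, p.86] -/
theorem ZdIdx.lamB_subset_towerBondsP {L : ℕ} (i : ZdIdx d L) :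
    ∀ m, m ≤ i.k → ∀ j, j ≤ m → i.Λb m j ⊆ towerBondsP L i.Ω (i.Λs m) j :=
  fun m hm j hj => (B8IdxB8LawsB.ZdIdx.Λb_subset_towerBonds i m hm j hj).trans (towerBonds_subset_towerBondsP L i.hΩ (i.Λs m) j)

/-- **AT A LAW MEMBER (№12 `Λb = towerBonds`) the inclusion holds at ALL `(m, j)`** (no `j ≤ m ≤ k` side condition).
[cite: Balaban1985RegularSpaces, (1.31) p.82, p.86 («𝔅_k»)] -/
theorem IdxB8LawsB.lamB_subset_towerBondsP {L : ℕ} {i : ZdIdx d L} (h : IdxB8LawsB L i) (m j : ℕ) :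
    i.Λb m j ⊆ towerBondsP L i.Ω (i.Λs m) j := by
  rw [h.bonds m j]
  exact towerBonds_subset_towerBondsP L i.hΩ (i.Λs m) j

variable {θ : Stage3Params}

/-- The same on the sub-index of record `IdxB8SubB θ`. [cite: Balaban1985RegularSpaces, (1.31) p.82, p.86 (bookkeeping)] -/
theorem IdxB8SubB.lamB_subset_towerBondsP (i : IdxB8SubB θ) (m j : ℕ) :
    i.1.1.Λb m j ⊆ towerBondsP θ.L i.1.1.Ω (i.1.1.Λs m) j :=
  IdxB8LawsB.lamB_subset_towerBondsP i.2 m j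

/-- **THE γ LAWS AT A MEMBER'S OWN TOWER** (`ZdIdx.hbox`∕`.hclass` shape for the class map `(m, j) ↦ towerBondsP L i.Ω (i.Λs m) j`, box law at
`Ω (j − 1)`). [cite: Balaban1985RegularSpaces, (1.31) p.82, (1.42) p.83] -/
theorem ZdIdx.towerBondsP_laws {L : ℕ} (i : ZdIdx d L) :
    (∀ m, m ≤ i.k → ∀ j, j ≤ m → ∀ c ∈ towerBondsP L i.Ω (i.Λs m) j, ∀ x, InBox (loK L j c.1) (bondHiK L j c.1 c.2) x → x ∈ i.Ω (j - 1)) ∧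
    (∀ m, m ≤ i.k → ∀ j, j ≤ m → ∀ c ∈ towerBondsP L i.Ω (i.Λs m) j,
      (c.1 ∈ i.Λs m j ∧ c.1 + e c.2 ∈ i.Λs m j) ∨
      (∃ j', j = j' + 1 ∧ (∀ x, (L : ℤ) • c.1 ≤ x → x ≤ (L : ℤ) • c.1 + blockTop L → x ∈ i.Λs m j') ∧ c.1 + e c.2 ∈ i.Λs m j) ∨
      (∃ j', j = j' + 1 ∧ c.1 ∈ i.Λs m j ∧ (∀ x, (L : ℤ) • (c.1 + e c.2) ≤ x → x ≤ (L : ℤ) • (c.1 + e c.2) + blockTop L → x ∈ i.Λs m j'))) :=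
  B8TowerBondsPrinted.towerBondsP_laws L i.hΩ i.Λs i.k

/-- **The A6 hook at truncation `0`**: at a tower with `Ω_0 = ℤᵈ` and `Λs 0 0 = ℤᵈ` (every `Ω₀ = ℤᵈ` law member, `B8IdxB8LawsCoverZero.lamS_zero_zero_eq_univ`)
EVERY bond is a level-`0` member of print's class at truncation `0`. [cite: Balaban1985RegularSpaces, p.77, (1.6) p.77, (1.31) p.82] -/
theorem mem_towerBondsP_zero_zero (L : ℕ) {Ω : ℕ → Set (Site d)} {Λs : ℕ → ℕ → Set (Site d)} (hΩ : Ω 0 = Set.univ)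
    (hΛ : Λs 0 0 = Set.univ) (b : Site d × Fin d) : b ∈ towerBondsP L Ω (Λs 0) 0 := by
  rw [towerBondsP_univ_self L hΩ hΛ]
  trivial

end Literature.MathematicalPhysics.QuantumFieldTheory.Balaban1983to89.B8TowerBondsPrinted

end
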